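/-
Origin: expansion seat `planner-pub-hodgecm-toy-g2-0`, handover #7 2026-08-18T06:51:05Z (`HOME/pub-hodgecm-toy-g2/lean/ToyG2/HodgeWeight.lean`, md5 26dc3db2, 321 lines);
landed by the gen-7 packager in gate run 25 as `HodgeCM/Model/ToyG2/HodgeWeight.lean` (verbatim).
-/
/-
Copyright (c) 2026. All rights reserved.
Released under Apache 2.0 license as described in the file LICENSE.
-/
import Mathlib
import Summits.HodgeConjecture.HodgeCM.Model.Toy.ExteriorHodge
import Summits.HodgeConjecture.HodgeCM.Model.Toy.Duality_4

/-!
# ToyG2.HodgeWeight — the weight operator of the toy Hodge structures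

For an object `X` of the gen-1 consistency model (`HodgeCM.Toy.Obj`: a family of CM atoms with
`H^k = ⋀^k (L X)` and the eigen-monomial Hodge filtration `FF k p` of `EigenBasis.lean`) we define,
for `z : ℂ`, the **weight operator**

* `X.wtL z : ℂ ⊗ L X → ℂ ⊗ L X`, `e_s ↦ z • e_s` for holomorphic indices `s`, `e_s ↦ e_s` else;
* `X.wt z k := ⋀^k (X.wtL z)`, acting on the eigen-monomial `e_g` by `z ^ cnt g` (`wt_mono`).

Results:
* `wt_wedge`, `wt_mul`, `wt_one`, `wtEquiv` (invertible for `z ≠ 0`);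
* `IsHodge.wtL_comp`, `wt_comp_map`: pull-backs along Hodge maps COMMUTE with the weight operator
  (a Hodge map preserves `F¹ = ker (wtL z - z)` and `conj F¹ = ker (wtL z - 1)`);
* `mem_FF_of_wt_eq`: for `z ≠ 0` with `z ^ n ≠ 1` (`0 < n ≤ k`), an eigenvector of `X.wt z k` with
  eigenvalue `z ^ m` (`m ≤ k`) lies in `FF k m`; hence (`mem_hodgeClasses_of_wt_eq`) a RATIONAL
  class `v ∈ ⋀^{2m} L X` whose complexification is such an eigenvector is a Hodge class of
  `X.hodgeStructure (2m)`.  With `ToyG2.EquivRepr` (`IsCanonRepr.fixed` for the pair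
  `(z⁻² · wt z 4, z^{-(d-2)} · wt z (2d-4))`) this is how the gen-2 model proves that its Gysin
  classes are Hodge, i.e. algebraic (`HOME/pub-hodgecm-toy-g2/DESIGN.md` §7).
-/

namespace HodgeCM.Toy

open scoped TensorProduct Classical
open exteriorPower Module
open Literature.AlgebraicGeometry.Motives

noncomputable section

namespace Obj

variable (X : Obj)

/-! ### The weight operator on `ℂ ⊗ L X` -/

/-- `wtL z (e_s) = z • e_s` for holomorphic `s`, `= e_s` otherwise. -/
def wtL (z : ℂ) : X.LC →ₗ[ℂ] X.LC :=
  X.eB.constr ℂ fun s => (if X.hol s then z else (1 : ℂ)) • X.eB s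

/-- (Ported verbatim from the HodgeCMPerL package; no docstring in the source.) -/
@[simp] lemma wtL_eB (z : ℂ) (s : X.Idx) :
    X.wtL z (X.eB s) = (if X.hol s then z else (1 : ℂ)) • X.eB s := by
  simp only [wtL, Basis.constr_basis]

/-- (Ported verbatim from the HodgeCMPerL package; no docstring in the source.) -/
lemma wtL_eB_of_hol (z : ℂ) {s : X.Idx} (hs : X.hol s) : X.wtL z (X.eB s) = z • X.eB s := by
  rw [wtL_eB, if_pos hs]

/-- (Ported verbatim from the HodgeCMPerL package; no docstring in the source.) -/
lemma wtL_eB_of_not_hol (z : ℂ) {s : X.Idx} (hs : ¬ X.hol s) : X.wtL z (X.eB s) = X.eB s := by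
  rw [wtL_eB, if_neg hs, one_smul]

/-- `wtL z` acts by `z` on `F¹`. -/
lemma wtL_apply_of_mem_F1 (z : ℂ) {x : X.LC} (hx : x ∈ X.F1) : X.wtL z x = z • x := by
  rw [F1_eq_span] at hx
  induction hx using Submodule.span_induction with
  | mem y hy =>
    obtain ⟨s, hs, rfl⟩ := hy
    exact X.wtL_eB_of_hol z hs
  | zero => simp
  | add a b _ _ ha hb => rw [map_add, ha, hb, smul_add]
  | smul c a _ ha => rw [map_smul, ha, smul_comm]

/-- `conj e_s = e_{s̄}`. -/
lemma conj_eB (s : X.Idx) : HodgeStructure.conj (X.eB s) = X.eB (X.bar s) := by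
  rw [eB_apply', eB_apply']
  show HodgeStructure.conj (X.eT s.1 s.2) = X.eT s.1 (NumberField.ComplexEmbedding.conjugate s.2)
  unfold eT
  rw [HodgeStructure.conj_baseChange, conj_eps]

/-- `conj F¹ = ⟨e_s | s antiholomorphic⟩`. -/
lemma complexConj_F1 :
    HodgeStructure.complexConj X.F1 = Submodule.span ℂ (X.eB '' {s | ¬ X.hol s}) := by
  rw [F1_eq_span, complexConj_span]
  congr 1
  ext y
  constructor
  · rintro ⟨_, ⟨s, hs, rfl⟩, rfl⟩
    refine ⟨X.bar s, ?_, (X.conj_eB s).symm⟩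
    show ¬ X.hol (X.bar s)
    rw [hol_bar_iff, not_not]
    exact hs
  · rintro ⟨s, hs, rfl⟩
    refine ⟨X.eB (X.bar s), ⟨X.bar s, ?_, rfl⟩, ?_⟩
    · show X.hol (X.bar s)
      rw [hol_bar_iff]
      exact hs
    · rw [conj_eB, bar_bar]

/-- `wtL z` acts trivially on `conj F¹`. -/
lemma wtL_apply_of_mem_conjF1 (z : ℂ) {x : X.LC} (hx : x ∈ HodgeStructure.complexConj X.F1) :
    X.wtL z x = x := by
  rw [complexConj_F1] at hx
  induction hx using Submodule.span_induction with
  | mem y hy =>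
    obtain ⟨s, hs, rfl⟩ := hy
    exact X.wtL_eB_of_not_hol z hs
  | zero => simp
  | add a b _ _ ha hb => rw [map_add, ha, hb]
  | smul c a _ ha => rw [map_smul, ha]

/-- (Ported verbatim from the HodgeCMPerL package; no docstring in the source.) -/
lemma eB_mem_complexConj_F1 {s : X.Idx} (hs : ¬ X.hol s) :
    X.eB s ∈ HodgeStructure.complexConj X.F1 := by
  rw [complexConj_F1]
  exact Submodule.subset_span ⟨s, hs, rfl⟩

variable {X}

/-- A Hodge map also maps `conj F¹` into `conj F¹`. -/
lemma IsHodge.map_complexConj_F1 {Y : Obj} {φ : Y.L →ₗ[ℚ] X.L} (hφ : IsHodge φ) :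
    (HodgeStructure.complexConj Y.F1).map (φ.baseChange ℂ) ≤ HodgeStructure.complexConj X.F1 := by
  rintro _ ⟨y, hy, rfl⟩
  simp only [SetLike.mem_coe, HodgeStructure.mem_complexConj] at hy ⊢
  rw [HodgeStructure.conj_baseChange]
  exact hφ ⟨_, hy, rfl⟩

/-- **Hodge maps commute with the weight operator.** -/
theorem IsHodge.wtL_comp {Y : Obj} {φ : Y.L →ₗ[ℚ] X.L} (hφ : IsHodge φ) (z : ℂ) :
    X.wtL z ∘ₗ φ.baseChange ℂ = φ.baseChange ℂ ∘ₗ Y.wtL z := by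
  refine Y.eB.ext fun s => ?_
  simp only [LinearMap.comp_apply]
  by_cases hs : Y.hol s
  · rw [Y.wtL_eB_of_hol z hs, map_smul, X.wtL_apply_of_mem_F1 z (hφ ⟨_, Y.eB_mem_F1 hs, rfl⟩)]
  · rw [Y.wtL_eB_of_not_hol z hs,
      X.wtL_apply_of_mem_conjF1 z (hφ.map_complexConj_F1 ⟨_, Y.eB_mem_complexConj_F1 hs, rfl⟩)]

variable (X)

/-! ### The weight operator on `⋀^k (ℂ ⊗ L X)` -/

/-- `wt z k = ⋀^k (wtL z)`. -/
def wt (z : ℂ) (k : ℕ) : ⋀[ℂ]^k X.LC →ₗ[ℂ] ⋀[ℂ]^k X.LC := map k (X.wtL z)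

/-- `wt z (e_g) = z ^ cnt g • e_g`. -/
lemma wt_mono (z : ℂ) (k : ℕ) (g : Fin k → X.Idx) :
    X.wt z k (X.mono k g) = z ^ X.cnt g • X.mono k g := by
  rw [wt, map_mono]
  have h : (fun j => X.wtL z (X.eB (g j)))
      = fun j => (fun j => if X.hol (g j) then z else (1 : ℂ)) j • (fun j => X.eB (g j)) j := by
    funext j
    exact X.wtL_eB z (g j)
  rw [h, AlternatingMap.map_smul_univ, Finset.prod_ite, Finset.prod_const, Finset.prod_const_one,
    mul_one, ← cnt_eq_card_filter]
  rfl

/-- (Ported verbatim from the HodgeCMPerL package; no docstring in the source.) -/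
lemma wt_wedge (z : ℂ) (i j : ℕ) (a : ⋀[ℂ]^i X.LC) (b : ⋀[ℂ]^j X.LC) :
    X.wt z (i + j) (wedge ℂ X.LC i j a b) = wedge ℂ X.LC i j (X.wt z i a) (X.wt z j b) :=
  map_wedge i j _ a b

/-- (Ported verbatim from the HodgeCMPerL package; no docstring in the source.) -/
lemma wt_mul (z z' : ℂ) (k : ℕ) : X.wt z k ∘ₗ X.wt z' k = X.wt (z * z') k := by
  refine LinearMap.ext_on_range (X.span_mono_eq_top k) fun g => ?_
  rw [LinearMap.comp_apply, wt_mono, map_smul, wt_mono, wt_mono, smul_smul, mul_pow, mul_comm]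

/-- (Ported verbatim from the HodgeCMPerL package; no docstring in the source.) -/
lemma wt_one (k : ℕ) : X.wt 1 k = LinearMap.id := by
  refine LinearMap.ext_on_range (X.span_mono_eq_top k) fun g => ?_
  rw [wt_mono, one_pow, one_smul, LinearMap.id_apply]

/-- For `z ≠ 0` the weight operator is invertible. -/
def wtEquiv (z : ℂ) (hz : z ≠ 0) (k : ℕ) : ⋀[ℂ]^k X.LC ≃ₗ[ℂ] ⋀[ℂ]^k X.LC :=
  LinearEquiv.ofLinear (X.wt z k) (X.wt z⁻¹ k)
    (by rw [wt_mul, mul_inv_cancel₀ hz, wt_one]) (by rw [wt_mul, inv_mul_cancel₀ hz, wt_one])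

/-- (Ported verbatim from the HodgeCMPerL package; no docstring in the source.) -/
@[simp] lemma wtEquiv_apply (z : ℂ) (hz : z ≠ 0) (k : ℕ) (x : ⋀[ℂ]^k X.LC) :
    X.wtEquiv z hz k x = X.wt z k x := rfl

variable {X} in
/-- **Naturality**: pull-back along a morphism commutes with the weight operators. -/
theorem wt_comp_map {Y : Obj} (f : Hom X Y) (z : ℂ) (k : ℕ) :
    X.wt z k ∘ₗ map k (f.lin.baseChange ℂ) = map k (f.lin.baseChange ℂ) ∘ₗ Y.wt z k := by
  rw [wt, wt, ← map_comp, ← map_comp, f.hodge.wtL_comp]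

/-! ### Eigenvectors of the weight operator are sums of pure monomials -/

/-- (`HodgeCM.Toy.basis_eq_mono`, gen 1: the wedge-basis vector at `S` is the monomial of the
increasing enumeration `enum X S` of `S`.) Its holomorphic count is `nhol S`. -/
lemma cnt_enum (k : ℕ) (S : Set.powersetCard X.Idx k) : X.cnt (enum X S) = X.nhol S.val := by
  rw [← X.nhol_image _ (enum_injective X S), image_enum]

/-- (Ported verbatim from the HodgeCMPerL package; no docstring in the source.) -/
lemma nhol_le {k : ℕ} (S : Set.powersetCard X.Idx k) : X.nhol S.val ≤ k := by
  have hS : S.val.card = k := S.prop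
  unfold nhol
  exact (Finset.card_filter_le _ _).trans_eq hS

/-- (Ported verbatim from the HodgeCMPerL package; no docstring in the source.) -/
lemma wt_basis (z : ℂ) (k : ℕ) (S : Set.powersetCard X.Idx k) :
    X.wt z k (X.eB.exteriorPower k S) = z ^ X.nhol S.val • X.eB.exteriorPower k S := by
  rw [basis_eq_mono X S, wt_mono, cnt_enum]

/-- (Ported verbatim from the HodgeCMPerL package; no docstring in the source.) -/
lemma basis_mem_FF {k : ℕ} {p : ℤ} (S : Set.powersetCard X.Idx k) (h : p ≤ (X.nhol S.val : ℤ)) :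
    X.eB.exteriorPower k S ∈ X.FF k p := by
  rw [basis_eq_mono X S]
  exact X.mono_mem_FF (by rwa [cnt_enum])

/-- distinct small powers of a generic `z` are distinct -/
lemma pow_ne_pow_of_generic {z : ℂ} {k : ℕ} (hz0 : z ≠ 0)
    (hz : ∀ n : ℕ, 0 < n → n ≤ k → z ^ n ≠ 1) {a b : ℕ} (ha : a ≤ k) (hb : b ≤ k) (hab : a ≠ b) :
    z ^ a ≠ z ^ b := by
  wlog h : a < b generalizing a b
  · exact fun h' => this hb ha hab.symm (lt_of_le_of_ne (not_lt.mp h) hab.symm) h'.symm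
  intro h'
  apply hz (b - a) (Nat.sub_pos_of_lt h) ((Nat.sub_le b a).trans hb)
  have hsplit : z ^ b = z ^ a * z ^ (b - a) := by
    rw [← pow_add, Nat.add_sub_cancel' h.le]
  rw [hsplit] at h'
  exact (mul_eq_left₀ (pow_ne_zero a hz0)).mp h'.symm

/-- `2` is generic. -/
lemma two_generic (n : ℕ) (hn : 0 < n) : (2 : ℂ) ^ n ≠ 1 := by
  intro h
  have h1 : ‖(2 : ℂ) ^ n‖ = 1 := by rw [h, norm_one]
  rw [norm_pow, Complex.norm_ofNat] at h1
  have h2 : (2 : ℝ) ^ 1 ≤ 2 ^ n := pow_le_pow_right₀ (by norm_num) hn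
  rw [h1, pow_one] at h2
  norm_num at h2

/-- coordinates of `wt z k x` in the wedge basis -/
lemma repr_wt (z : ℂ) (k : ℕ) (x : ⋀[ℂ]^k X.LC) (S : Set.powersetCard X.Idx k) :
    (X.eB.exteriorPower k).repr (X.wt z k x) S
      = z ^ X.nhol S.val * (X.eB.exteriorPower k).repr x S := by
  set B := X.eB.exteriorPower k with hB
  have key : B.coord S ∘ₗ X.wt z k = z ^ X.nhol S.val • B.coord S := by
    refine B.ext fun T => ?_
    rw [LinearMap.comp_apply, hB, wt_basis, map_smul, LinearMap.smul_apply, Basis.coord_apply,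
      Basis.repr_self, Finsupp.single_apply]
    by_cases hTS : T = S
    · subst hTS
      simp
    · rw [if_neg hTS, smul_zero, smul_zero]
  have h := LinearMap.congr_fun key x
  rw [LinearMap.comp_apply, LinearMap.smul_apply, Basis.coord_apply, smul_eq_mul] at h
  rw [hB] at h ⊢
  exact h

/-- If `wt z k x = z ^ m • x` for a generic `z` (`m ≤ k`), the wedge-coordinates of `x` off the
monomials with exactly `m` holomorphic factors vanish. -/
lemma repr_eq_zero_of_wt_eq {z : ℂ} {k : ℕ} (hz0 : z ≠ 0)
    (hz : ∀ n : ℕ, 0 < n → n ≤ k → z ^ n ≠ 1) {m : ℕ} (hm : m ≤ k) {x : ⋀[ℂ]^k X.LC}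
    (hx : X.wt z k x = z ^ m • x) (S : Set.powersetCard X.Idx k) (hS : X.nhol S.val ≠ m) :
    (X.eB.exteriorPower k).repr x S = 0 := by
  have h := X.repr_wt z k x S
  rw [hx, map_smul, Finsupp.smul_apply, smul_eq_mul] at h
  -- h : z ^ m * c = z ^ nhol * c
  have h' : (z ^ X.nhol S.val - z ^ m) * (X.eB.exteriorPower k).repr x S = 0 := by
    rw [sub_mul, ← h, sub_self]
  rcases mul_eq_zero.mp h' with h1 | h1
  · exact absurd (sub_eq_zero.mp h1) (pow_ne_pow_of_generic hz0 hz (X.nhol_le S) hm hS)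
  · exact h1

/-- the span of the monomials with exactly `m` holomorphic factors -/
def pureSpan (k m : ℕ) : Submodule ℂ (⋀[ℂ]^k X.LC) :=
  Submodule.span ℂ {x | ∃ g : Fin k → X.Idx, X.cnt g = m ∧ x = X.mono k g}

/-- (Ported verbatim from the HodgeCMPerL package; no docstring in the source.) -/
lemma pureSpan_le_FF (k m : ℕ) : X.pureSpan k m ≤ X.FF k m := by
  rw [pureSpan, Submodule.span_le]
  rintro _ ⟨g, hg, rfl⟩
  exact X.mono_mem_FF (by rw [hg])

/-- (Ported verbatim from the HodgeCMPerL package; no docstring in the source.) -/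
lemma wt_eq_of_mem_pureSpan (z : ℂ) {k m : ℕ} {x : ⋀[ℂ]^k X.LC} (hx : x ∈ X.pureSpan k m) :
    X.wt z k x = z ^ m • x := by
  induction hx using Submodule.span_induction with
  | mem y hy =>
    obtain ⟨g, hg, rfl⟩ := hy
    rw [wt_mono, hg]
  | zero => simp
  | add a b _ _ ha hb => rw [map_add, ha, hb, smul_add]
  | smul c a _ ha => rw [map_smul, ha, smul_comm]

/-- **Eigenvectors of the weight operator** (generic `z`, `m ≤ k`): `wt z k x = z ^ m • x` iff
`x` is a combination of monomials with exactly `m` holomorphic factors. -/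
theorem mem_pureSpan_of_wt_eq {z : ℂ} {k : ℕ} (hz0 : z ≠ 0)
    (hz : ∀ n : ℕ, 0 < n → n ≤ k → z ^ n ≠ 1) {m : ℕ} (hm : m ≤ k) {x : ⋀[ℂ]^k X.LC}
    (hx : X.wt z k x = z ^ m • x) : x ∈ X.pureSpan k m := by
  rw [← (X.eB.exteriorPower k).sum_repr x]
  refine Submodule.sum_mem _ fun S _ => ?_
  by_cases hS : X.nhol S.val = m
  · refine Submodule.smul_mem _ _ ?_
    rw [basis_eq_mono X S]
    exact Submodule.subset_span ⟨_, by rw [cnt_enum, hS], rfl⟩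
  · rw [X.repr_eq_zero_of_wt_eq hz0 hz hm hx S hS, zero_smul]
    exact zero_mem _

/-- (Ported verbatim from the HodgeCMPerL package; no docstring in the source.) -/
theorem mem_pureSpan_iff_wt_eq {z : ℂ} {k : ℕ} (hz0 : z ≠ 0)
    (hz : ∀ n : ℕ, 0 < n → n ≤ k → z ^ n ≠ 1) {m : ℕ} (hm : m ≤ k) (x : ⋀[ℂ]^k X.LC) :
    x ∈ X.pureSpan k m ↔ X.wt z k x = z ^ m • x :=
  ⟨X.wt_eq_of_mem_pureSpan z, X.mem_pureSpan_of_wt_eq hz0 hz hm⟩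

/-- … hence such an eigenvector lies in `FF k m`. -/
theorem mem_FF_of_wt_eq {z : ℂ} {k : ℕ} (hz0 : z ≠ 0) (hz : ∀ n : ℕ, 0 < n → n ≤ k → z ^ n ≠ 1)
    {m : ℕ} (hm : m ≤ k) {x : ⋀[ℂ]^k X.LC} (hx : X.wt z k x = z ^ m • x) :
    x ∈ X.FF k (m : ℤ) :=
  X.pureSpan_le_FF k m (X.mem_pureSpan_of_wt_eq hz0 hz hm hx)

/-- **Hodge classes from weight-eigenvectors**: a rational class of degree `2m` whose
complexification is a `z ^ m`-eigenvector of `wt z (2m)` (generic `z`) is a Hodge class. -/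
theorem mem_hodgeClasses_of_wt_eq {z : ℂ} {m : ℕ} (hz0 : z ≠ 0)
    (hz : ∀ n : ℕ, 0 < n → n ≤ 2 * m → z ^ n ≠ 1) {v : ↥(⋀[ℚ]^(2 * m) X.L)}
    (hv : X.wt z (2 * m) (X.Θ (2 * m) (HodgeStructure.ofRat v))
      = z ^ m • X.Θ (2 * m) (HodgeStructure.ofRat v)) :
    v ∈ (X.hodgeStructure (2 * m)).hodgeClasses (m : ℤ) := by
  rw [HodgeStructure.mem_hodgeClasses_iff]
  show HodgeStructure.ofRat v ∈ X.hodgeF (2 * m) m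
  rw [mem_hodgeF]
  exact X.mem_FF_of_wt_eq hz0 hz (by omega) hv

/-- The same with `z = 2`. -/
theorem mem_hodgeClasses_of_wt_two {m : ℕ} {v : ↥(⋀[ℚ]^(2 * m) X.L)}
    (hv : X.wt 2 (2 * m) (X.Θ (2 * m) (HodgeStructure.ofRat v))
      = (2 : ℂ) ^ m • X.Θ (2 * m) (HodgeStructure.ofRat v)) :
    v ∈ (X.hodgeStructure (2 * m)).hodgeClasses (m : ℤ) :=
  X.mem_hodgeClasses_of_wt_eq two_ne_zero (fun n hn _ => two_generic n hn) hv

end Obj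

end

end HodgeCM.Toy
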